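/-
Copyright (c) 2026. All rights reserved.
Released under Apache 2.0 license as described in the file LICENSE.
-/
import Literature.MathematicalPhysics.QuantumLattice.HartreeFockBlochTorus
import Literature.MathematicalPhysics.QuantumLattice.HartreeFockBernoulliDecomposition
import Literature.MathematicalPhysics.QuantumLattice.HubbardBoxSectorEnergyBounds
import Mathlib.Analysis.Matrix.PosDef
import HarnessLib

/-!
# Bloch-state upper bounds for NON-idempotent blocks `0 ≤ Q ≤ 1` (Lieb's variational principle, collinear Hubbard case)

Topic `MathematicalPhysics/QuantumLattice`, family `hubbard`; continuation of `HartreeFockBlochTorus.lean`.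
There, `HartreeFock.hubbardTorus_groundEnergyAt_le_bloch` / `energyDensity2D_le_bloch` bound the Hubbard
torus energy (resp. the square-lattice energy density) by the cell expression `blochEnergy t U Q` of a
collinear Bloch (magnetic-cell periodic) Slater state, for cell-momentum blocks `Q σ κ` that are Hermitian
IDEMPOTENTS (`Q² = Q`). This file removes idempotency: for `U ≥ 0` the same bound holds for every family
of blocks with `0 ≤ Q σ κ ≤ 1` in the Loewner order (`Matrix.PosSemidef (Q σ κ)` and
`Matrix.PosSemidef (1 - Q σ κ)`), at the mean filling `n̄ = re Σ_{σ,κ} tr Q σ κ / L²`: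

* **`energyDensity2D_le_bloch_of_posSemidef`** — `d = 2`, `L ≥ 3`, cell sides `M i ≥ 2`,
  `k i · M i = L`, `0 < n̄ < 2`:  `e(t, U; n̄) ≤ re blochEnergy t U Q / L² + 16|t|/L`.

This is Lieb's variational principle (`E^Q ≤ E^{HF}(γ)` for all one-body `0 ≤ γ ≤ 1`, BLS94
(2c.34)–(2c.36), Lieb 1981) in the spin-diagonal Hubbard setting, where the interaction
`U |k| Σ_x̄ ρ↑(x̄) ρ↓(x̄)` has no exchange term between the two spins and the proof is elementary:

* (M1, the tree's `HartreeFockBernoulliDecomposition.lean`, REUSED) **product-Bernoulli decomposition**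
  of one Hermitian `A` (`A : Matrix n n ℂ`): the spectral 0/1-projectors
  `bernoulliProj hA ε = U diag(1[ε i]) Uᴴ` (`ε : n → Bool`) and weights
  `bernoulliWeight hA ε = Π_i (λ_i if ε i else 1 - λ_i)` with `Σ_ε w(ε) = 1`,
  `Σ_ε w(ε) F_ε = A`, each `F_ε` a Hermitian idempotent with `tr F_ε = #{i | ε i}`; here
  (`section Bernoulli`) only the passage from the Loewner hypotheses `0 ≤ A`, `A ≤ 1` to
  `0 ≤ λ_i ≤ 1` (so `w ≥ 0`) and `F_⊤ = 1`.
* (`section Affine`) `blochEnergy = -t · blochKinetic + U |k| · blochInteraction` with the kinetic part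
  LINEAR in the family and the cell density `blochDensity` linear in the spin family; hence
  **`blochEnergy_sum_smul_of_spin_eq`**: `blochEnergy (Σ_e c_e X_e) = Σ_e c_e blochEnergy (X_e)` whenever
  `Σ c = 1` and the `X_e` share the blocks of one spin (bi-affine, NOT jointly affine: a joint convex
  combination of the two spins goes the wrong way for `U > 0`).
* (M2, `sections Mixture, Thermodynamic`) release the blocks ONE AT A TIME (`mixFamily Q hQh S E`: blocks in
  `S` original, the others replaced by the spectral projectors selected by the patterns `E`;
  `mixFamily_insert`: releasing `b ∉ S` is the `w_b`-average over the patterns of `b`, a one-spin mixture),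
  so both `re blochEnergy` and the total trace split with the same nonnegative weights
  (`totalTrace_sum_smul`); Finset induction on `S` from the base case `mixture_base` (all blocks
  projectors): the member has an INTEGER particle number `N = Σ #{ε}`; for `N < 2L²` the tree's
  `hubbardTorus_groundEnergyAt_le_bloch` + `groundEnergyAt_fermionTorusGraph_two` +
  `ThermodynamicLimit.energyDensity2D_le_of_lt` give `e(N/L²) ≤ re blochEnergy(member)/L² + 16|t|/L` and a
  supporting line of the convex `e` at `n̄` (`exists_supporting_line_energyDensity2D`) turns the left side
  into `e(n̄) + s (N/L² - n̄)`; the filled member `N = 2L²` is the all-ones family (`blochEnergy_one`: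
  `re blochEnergy = U L²`, the kinetic diagonal vanishes because `M i ≥ 2` makes `x̄ + eᵢ ≠ x̄`) against
  `supporting_line_at_two_le` (`e(n̄) + s(2 - n̄) ≤ U`). Summing the members with the weights (they do
  NOT carry the filling `n̄`; Jensen absorbs their integer fillings) and ending at `S = univ`
  (`mixFamily_univ = Q`) gives the theorem.

Use (certified "UHF"/quasi-free upper bounds, FORMAT-qf1 of the CertifiedManyBodySolver venture): a
certificate's translation-invariant one-body data give blocks `Q σ κ` by a finite character sum; the
reader-checked `δ`-certificate and affine shrink give exactly the two `PosSemidef` hypotheses per block;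
this theorem then replaces the infinite-volume quasi-free-state (Araki) glue by finite matrices.
Deliberately NOT here: the certificate format (blocks from `γ_σ(R)`), the `δ`-shrink lemma, the
`L → ∞` corollary, `t' ≠ 0`, dressed (non-Slater) references, `d ≠ 2` thermodynamic limits, cells with a
side `1` (write them as side-`2` cells).

Everything is proved; definitions have bodies; no named facts.

## Mathlib / tree search

Tree (REUSED): `HartreeFock.bernoulliProj`, `bernoulliWeight`, `isHermitian_bernoulliProj`,
`bernoulliProj_mul_self`, `trace_bernoulliProj`, `bernoulliWeight_nonneg`, `sum_bernoulliWeight`,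
`sum_bernoulliWeight_smul_bernoulliProj` (`HartreeFockBernoulliDecomposition`, Lieb 1981 eq. (4));
`HartreeFock.blochEnergy`, `blochDensity`, `facePhase`, `card_cells_ne_zero`,
`hubbardTorus_groundEnergyAt_le_bloch` (`HartreeFockBlochTorus`), `HeisenbergTL.card_rectTorusSite_eq_prod`,
`groundEnergyAt_fermionTorusGraph_two` (`HubbardRectangularTorus`),
`ThermodynamicLimit.energyDensity2D_le_of_lt`, `exists_supporting_line_energyDensity2D`,
`supporting_line_at_two_le` (`HubbardBoxSectorEnergyBounds`), `convexOn_energyDensity2D`.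
Mathlib: `Matrix.IsHermitian.spectral_theorem`, `IsHermitian.posSemidef_iff_eigenvalues_nonneg`,
`Matrix.IsUnit.posSemidef_star_right_conjugate_iff`, `posSemidef_diagonal_iff`,
`Finset.sum_eq_sum_iff_of_le`, `Finset.induction_on`.
`lean search 'variational principle|Lieb 1981|posSemidef bloch'`: no Hartree–Fock bound for
non-idempotent one-body matrices in the tree (only the projection case) or Mathlib.

## References

* V. Bach, E. H. Lieb, J. P. Solovej, *Generalized Hartree–Fock theory and the Hubbard model*,
  J. Stat. Phys. 76 (1994) 3–89, eqs. (2c.8), (2c.34)–(2c.36) and Thm 2.12 (= Lieb's variational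
  principle). [BachLiebSolovej1994]
* E. H. Lieb, *Variational principle for many-fermion systems*, Phys. Rev. Lett. 46 (1981) 457–459;
  erratum 47 (1981) 69 (= BLS94 Thm 2.12). [Lieb1981]
-/

noncomputable section

namespace Literature.MathematicalPhysics.QuantumLattice

namespace HartreeFock

open Matrix Finset Literature.Probability.LatticeModels HeisenbergTL

open scoped ComplexConjugate ComplexOrder

/-! ### From the Loewner order `0 ≤ A ≤ 1` to the product-Bernoulli decomposition -/

section Bernoulli

variable {n : Type*} [Fintype n] [DecidableEq n] {A : Matrix n n ℂ} (hA : A.IsHermitian)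

/-- The all-`true` pattern selects the identity: `F_⊤ = U Uᴴ = 1`. [folklore] -/
private theorem bernoulliProj_const_true : bernoulliProj hA (fun _ => true) = 1 := by
  unfold bernoulliProj
  simp only [if_true, diagonal_one, Matrix.mul_one]
  rw [← star_eq_conjTranspose]
  exact Unitary.coe_mul_star_self hA.eigenvectorUnitary

/-- The eigenvalues of `A` with `0 ≤ A` are nonnegative (Mathlib's
`IsHermitian.posSemidef_iff_eigenvalues_nonneg`). [folklore] -/
private theorem eigenvalues_nonneg_of_posSemidef (h0 : A.PosSemidef) (i : n) :
    0 ≤ hA.eigenvalues i :=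
  (hA.posSemidef_iff_eigenvalues_nonneg.mp h0) i

/-- The eigenvalues of `A` with `A ≤ 1` are at most one (`1 - A = U diag(1 - λ) Uᴴ ≥ 0`).
[folklore] -/
private theorem eigenvalues_le_one_of_posSemidef (h1 : (1 - A).PosSemidef) (i : n) :
    hA.eigenvalues i ≤ 1 := by
  have key : 1 - A = Unitary.conjStarAlgAut ℂ _ hA.eigenvectorUnitary
      (diagonal (fun i => ((1 - hA.eigenvalues i : ℝ) : ℂ))) := by
    conv_lhs => rw [hA.spectral_theorem]
    rw [show (1 : Matrix n n ℂ) = Unitary.conjStarAlgAut ℂ _ hA.eigenvectorUnitary 1 from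
      (map_one _).symm, ← map_sub]
    congr 1
    rw [← diagonal_one, diagonal_sub]
    congr 1
    funext i
    simp
  have h := h1
  rw [key, Unitary.conjStarAlgAut_apply,
    (Unitary.isUnit_coe (U := hA.eigenvectorUnitary)).posSemidef_star_right_conjugate_iff,
    posSemidef_diagonal_iff] at h
  have hi := h i
  rw [Complex.zero_le_real] at hi
  linarith

/-- The product-Bernoulli weights of `0 ≤ A ≤ 1` (Loewner) are nonnegative. [folklore] -/
private theorem bernoulliWeight_nonneg_of_posSemidef (h0 : A.PosSemidef) (h1 : (1 - A).PosSemidef)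
    (ε : n → Bool) : 0 ≤ bernoulliWeight hA ε :=
  bernoulliWeight_nonneg hA (eigenvalues_nonneg_of_posSemidef hA h0)
    (eigenvalues_le_one_of_posSemidef hA h1) ε

end Bernoulli

/-! ### `blochEnergy` is affine along families that differ in one spin only -/

section Affine

variable {d : ℕ} {k M : Fin d → ℕ} [∀ i, NeZero (k i)] [∀ i, NeZero (M i)]

/-- The kinetic (bond) part of `blochEnergy`:
`Σ_σ Σ_κ Σ_i Σ_{x̄} [θ_κ,i(x̄) Q σ κ (x̄+eᵢ, x̄) + conj θ_κ,i(x̄) Q σ κ (x̄, x̄+eᵢ)]`. [folklore] -/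
def blochKinetic (Q : Fin 2 → RectTorusSite k → Matrix (RectTorusSite M) (RectTorusSite M) ℂ) : ℂ :=
  ∑ σ, ∑ κ, ∑ i : Fin d, ∑ p : RectTorusSite M,
    (facePhase κ i p * Q σ κ (p + Pi.single i 1) p +
      conj (facePhase κ i p) * Q σ κ p (p + Pi.single i 1))

/-- The interaction part of `blochEnergy`: `Σ_{x̄} ρ↑(x̄) ρ↓(x̄)`. [folklore] -/
def blochInteraction (Q : Fin 2 → RectTorusSite k → Matrix (RectTorusSite M) (RectTorusSite M) ℂ) :
    ℂ :=
  ∑ p : RectTorusSite M, blochDensity (Q 0) p * blochDensity (Q 1) p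

/-- `blochEnergy = -t · kinetic + U |k| · interaction` (definitional): the Hartree–Fock functional is
the one-body (kinetic) term plus the direct term, BLS94 (2c.8) for the Bloch state.
[cite: BachLiebSolovej1994, eq. (2c.8)] -/
theorem blochEnergy_eq_kinetic_add_interaction (t U : ℝ)
    (Q : Fin 2 → RectTorusSite k → Matrix (RectTorusSite M) (RectTorusSite M) ℂ) :
    blochEnergy t U Q = -(t : ℂ) * blochKinetic Q +
      (U : ℂ) * (Fintype.card (RectTorusSite k) : ℂ) * blochInteraction Q := rfl

/-- The kinetic part is additive in the family. [folklore] -/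
private theorem blochKinetic_add (Q R : Fin 2 → RectTorusSite k → Matrix (RectTorusSite M) (RectTorusSite M) ℂ) :
    blochKinetic (Q + R) = blochKinetic Q + blochKinetic R := by
  unfold blochKinetic
  simp only [Pi.add_apply, Matrix.add_apply]
  rw [← Finset.sum_add_distrib]
  refine Finset.sum_congr rfl fun σ _ => ?_
  rw [← Finset.sum_add_distrib]
  refine Finset.sum_congr rfl fun κ _ => ?_
  rw [← Finset.sum_add_distrib]
  refine Finset.sum_congr rfl fun i _ => ?_
  rw [← Finset.sum_add_distrib]
  refine Finset.sum_congr rfl fun p _ => ?_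
  ring

/-- The kinetic part is homogeneous in the family. [folklore] -/
private theorem blochKinetic_smul (c : ℂ) (Q : Fin 2 → RectTorusSite k → Matrix (RectTorusSite M) (RectTorusSite M) ℂ) :
    blochKinetic (c • Q) = c * blochKinetic Q := by
  unfold blochKinetic
  simp only [Pi.smul_apply, Matrix.smul_apply, smul_eq_mul, Finset.mul_sum]
  refine Finset.sum_congr rfl fun σ _ => Finset.sum_congr rfl fun κ _ =>
    Finset.sum_congr rfl fun i _ => Finset.sum_congr rfl fun p _ => ?_
  ring

/-- The kinetic (one-body) part of the Hartree–Fock functional is LINEAR in the one-body matrix,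
here over finite combinations of block families. [cite: BachLiebSolovej1994, eq. (2c.8)] -/
theorem blochKinetic_sum_smul {ι : Type*} (s : Finset ι) (c : ι → ℂ)
    (X : ι → Fin 2 → RectTorusSite k → Matrix (RectTorusSite M) (RectTorusSite M) ℂ) :
    blochKinetic (∑ e ∈ s, c e • X e) = ∑ e ∈ s, c e * blochKinetic (X e) := by
  induction s using Finset.cons_induction with
  | empty =>
    simp only [Finset.sum_empty]
    unfold blochKinetic
    simp
  | cons a s ha ih => rw [Finset.sum_cons, Finset.sum_cons, blochKinetic_add, blochKinetic_smul, ih]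

omit [∀ i, NeZero (M i)] in
/-- The cell density is additive in the spin family. [folklore] -/
private theorem blochDensity_add (Q R : RectTorusSite k → Matrix (RectTorusSite M) (RectTorusSite M) ℂ)
    (p : RectTorusSite M) : blochDensity (Q + R) p = blochDensity Q p + blochDensity R p := by
  unfold blochDensity
  simp only [Pi.add_apply, Matrix.add_apply, Finset.sum_add_distrib, mul_add]

omit [∀ i, NeZero (M i)] in
/-- The cell density is homogeneous in the spin family. [folklore] -/
private theorem blochDensity_smul (c : ℂ) (Q : RectTorusSite k → Matrix (RectTorusSite M) (RectTorusSite M) ℂ)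
    (p : RectTorusSite M) : blochDensity (c • Q) p = c * blochDensity Q p := by
  unfold blochDensity
  simp only [Pi.smul_apply, Matrix.smul_apply, smul_eq_mul, ← Finset.mul_sum]
  ring

omit [∀ i, NeZero (M i)] in
/-- The density entering the direct term of the Hartree–Fock functional is LINEAR in the one-body
matrix, here the cell density over finite combinations of spin block families.
[cite: BachLiebSolovej1994, eq. (2c.8)] -/
theorem blochDensity_sum_smul {ι : Type*} (s : Finset ι) (c : ι → ℂ)
    (X : ι → RectTorusSite k → Matrix (RectTorusSite M) (RectTorusSite M) ℂ) (p : RectTorusSite M) :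
    blochDensity (∑ e ∈ s, c e • X e) p = ∑ e ∈ s, c e * blochDensity (X e) p := by
  induction s using Finset.cons_induction with
  | empty =>
    simp only [Finset.sum_empty]
    unfold blochDensity
    simp
  | cons a s ha ih => rw [Finset.sum_cons, Finset.sum_cons, blochDensity_add, blochDensity_smul, ih]

omit [∀ i, NeZero (k i)] [∀ i, NeZero (M i)] in
/-- Components of a finite combination of families. [folklore] -/
private theorem sum_smul_family_apply {ι : Type*} (s : Finset ι) (c : ι → ℂ)
    (X : ι → Fin 2 → RectTorusSite k → Matrix (RectTorusSite M) (RectTorusSite M) ℂ) (σ : Fin 2) :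
    (∑ e ∈ s, c e • X e) σ = ∑ e ∈ s, c e • X e σ := by
  simp only [Finset.sum_apply, Pi.smul_apply]

/-- **`blochEnergy` is affine along one-spin mixtures**: if the families `X e` all have the SAME
blocks in spin `τ` and `Σ c = 1`, then `blochEnergy (Σ_e c_e X_e) = Σ_e c_e blochEnergy (X_e)` (the
kinetic part is linear, the density of spin `τ` is common, the other density is linear). It is NOT
affine jointly in both spins (the interaction is bilinear). [cite: BachLiebSolovej1994, eq. (2c.8)] -/
theorem blochEnergy_sum_smul_of_spin_eq (t U : ℝ) {ι : Type*} (s : Finset ι) (c : ι → ℂ)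
    (hc : ∑ e ∈ s, c e = 1)
    (X : ι → Fin 2 → RectTorusSite k → Matrix (RectTorusSite M) (RectTorusSite M) ℂ) (τ : Fin 2)
    (G : RectTorusSite k → Matrix (RectTorusSite M) (RectTorusSite M) ℂ) (hG : ∀ e ∈ s, X e τ = G) :
    blochEnergy t U (∑ e ∈ s, c e • X e) = ∑ e ∈ s, c e * blochEnergy t U (X e) := by
  have hτ : ∀ p, blochDensity ((∑ e ∈ s, c e • X e) τ) p = blochDensity G p := by
    intro p
    rw [sum_smul_family_apply, blochDensity_sum_smul]
    calc ∑ e ∈ s, c e * blochDensity (X e τ) p = ∑ e ∈ s, c e * blochDensity G p :=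
          Finset.sum_congr rfl fun e he => by rw [hG e he]
      _ = blochDensity G p := by rw [← Finset.sum_mul, hc, one_mul]
  have hint : blochInteraction (∑ e ∈ s, c e • X e) = ∑ e ∈ s, c e * blochInteraction (X e) := by
    unfold blochInteraction
    have hτ2 : τ = 0 ∨ τ = 1 := by fin_cases τ <;> simp
    rcases hτ2 with rfl | rfl
    · -- spin 0 common
      simp_rw [hτ, sum_smul_family_apply, blochDensity_sum_smul, Finset.mul_sum]
      rw [Finset.sum_comm]
      refine Finset.sum_congr rfl fun e he => Finset.sum_congr rfl fun p _ => ?_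
      rw [hG e he]
      ring
    · -- spin 1 common
      simp_rw [hτ, sum_smul_family_apply, blochDensity_sum_smul, Finset.sum_mul, Finset.mul_sum]
      rw [Finset.sum_comm]
      refine Finset.sum_congr rfl fun e he => Finset.sum_congr rfl fun p _ => ?_
      rw [hG e he]
      ring
  rw [blochEnergy_eq_kinetic_add_interaction, blochKinetic_sum_smul, hint, Finset.mul_sum,
    Finset.mul_sum, ← Finset.sum_add_distrib]
  refine Finset.sum_congr rfl fun e _ => ?_
  rw [blochEnergy_eq_kinetic_add_interaction]
  ring

end Affine

/-! ### The total trace and the all-ones family -/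

section Total

variable {d : ℕ} {k M : Fin d → ℕ} [∀ i, NeZero (k i)] [∀ i, NeZero (M i)]

/-- `Σ_{σ,κ} tr` of a finite combination of families. [folklore] -/
private theorem totalTrace_sum_smul {ι : Type*} (s : Finset ι) (c : ι → ℂ)
    (X : ι → Fin 2 → RectTorusSite k → Matrix (RectTorusSite M) (RectTorusSite M) ℂ) :
    (∑ σ, ∑ κ, ((∑ e ∈ s, c e • X e) σ κ).trace) = ∑ e ∈ s, c e * ∑ σ, ∑ κ, (X e σ κ).trace := by
  have h1 : ∀ σ κ, ((∑ e ∈ s, c e • X e) σ κ).trace = ∑ e ∈ s, c e * (X e σ κ).trace := by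
    intro σ κ
    rw [Finset.sum_apply, Finset.sum_apply, Matrix.trace_sum]
    refine Finset.sum_congr rfl fun e _ => ?_
    rw [Pi.smul_apply, Pi.smul_apply, Matrix.trace_smul, smul_eq_mul]
  simp_rw [h1]
  calc ∑ σ, ∑ κ, ∑ e ∈ s, c e * (X e σ κ).trace
      = ∑ σ, ∑ e ∈ s, ∑ κ, c e * (X e σ κ).trace :=
        Finset.sum_congr rfl fun σ _ => Finset.sum_comm
    _ = ∑ e ∈ s, ∑ σ, ∑ κ, c e * (X e σ κ).trace := Finset.sum_comm
    _ = ∑ e ∈ s, c e * ∑ σ, ∑ κ, (X e σ κ).trace := by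
        refine Finset.sum_congr rfl fun e _ => ?_
        rw [Finset.mul_sum]
        refine Finset.sum_congr rfl fun σ _ => ?_
        rw [Finset.mul_sum]

omit [∀ i, NeZero (k i)] [∀ i, NeZero (M i)] in
/-- With cell sides `M i ≥ 2` the step `x̄ ↦ x̄ + eᵢ` inside the cell has no fixed point.
[folklore] -/
private theorem add_single_one_ne (hM : ∀ i, 2 ≤ M i) (p : RectTorusSite M) (i : Fin d) :
    p + Pi.single i 1 ≠ p := by
  intro h
  have hi := congrFun h i
  simp only [Pi.add_apply, Pi.single_eq_same, add_eq_left] at hi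
  haveI : Fact (1 < M i) := ⟨hM i⟩
  exact one_ne_zero hi

/-- The kinetic part of the all-ones family vanishes (no bond is a loop when `M i ≥ 2`).
[folklore] -/
private theorem blochKinetic_one (hM : ∀ i, 2 ≤ M i) :
    blochKinetic (k := k) (fun (_ : Fin 2) (_ : RectTorusSite k) =>
      (1 : Matrix (RectTorusSite M) (RectTorusSite M) ℂ)) = 0 := by
  unfold blochKinetic
  refine Finset.sum_eq_zero fun σ _ => Finset.sum_eq_zero fun κ _ =>
    Finset.sum_eq_zero fun i _ => Finset.sum_eq_zero fun p _ => ?_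
  beta_reduce
  rw [Matrix.one_apply_ne (add_single_one_ne hM p i),
    Matrix.one_apply_ne' (add_single_one_ne hM p i), mul_zero, mul_zero, add_zero]

omit [∀ i, NeZero (M i)] in
/-- The cell density of the all-ones spin family is `1`. [folklore] -/
private theorem blochDensity_one (p : RectTorusSite M) :
    blochDensity (k := k) (fun (_ : RectTorusSite k) =>
      (1 : Matrix (RectTorusSite M) (RectTorusSite M) ℂ)) p = 1 := by
  unfold blochDensity
  simp only [Matrix.one_apply_eq, Finset.sum_const, Finset.card_univ, nsmul_eq_mul, mul_one]
  exact inv_mul_cancel₀ card_cells_ne_zero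

/-- `|k| · |cell| = L^d`. [folklore] -/
private theorem card_cells_mul_card_cell {L : ℕ} (hkM : ∀ i, k i * M i = L) :
    Fintype.card (RectTorusSite k) * Fintype.card (RectTorusSite M) = L ^ d := by
  rw [card_rectTorusSite_eq_prod, card_rectTorusSite_eq_prod, ← Finset.prod_mul_distrib]
  rw [Finset.prod_congr rfl fun i _ => hkM i, Finset.prod_const, Finset.card_univ, Fintype.card_fin]

/-- The Bloch energy of the all-ones family (the filled band) is `U · L^d`. [folklore] -/
private theorem blochEnergy_one {L : ℕ} (hkM : ∀ i, k i * M i = L) (hM : ∀ i, 2 ≤ M i) (t U : ℝ) :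
    blochEnergy t U (fun (_ : Fin 2) (_ : RectTorusSite k) =>
      (1 : Matrix (RectTorusSite M) (RectTorusSite M) ℂ)) = (U : ℂ) * ((L ^ d : ℕ) : ℂ) := by
  rw [blochEnergy_eq_kinetic_add_interaction, blochKinetic_one hM, mul_zero, zero_add]
  unfold blochInteraction
  simp only [blochDensity_one, mul_one, Finset.sum_const, Finset.card_univ, nsmul_eq_mul]
  rw [← card_cells_mul_card_cell hkM]
  push_cast
  ring

/-- The total trace of the all-ones family is `2 L^d`. [folklore] -/
private theorem totalTrace_one {L : ℕ} (hkM : ∀ i, k i * M i = L) :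
    (∑ _σ : Fin 2, ∑ _κ : RectTorusSite k,
      (1 : Matrix (RectTorusSite M) (RectTorusSite M) ℂ).trace) = ((2 * L ^ d : ℕ) : ℂ) := by
  simp only [trace_one, Finset.sum_const, Finset.card_univ, nsmul_eq_mul, Fintype.card_fin]
  rw [← card_cells_mul_card_cell hkM]
  push_cast
  ring

end Total

/-! ### The partially decomposed ("mixture") families -/

section Mixture

variable {d : ℕ} {k M : Fin d → ℕ} [∀ i, NeZero (k i)] [∀ i, NeZero (M i)]
  (Q : Fin 2 → RectTorusSite k → Matrix (RectTorusSite M) (RectTorusSite M) ℂ)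
  (hQh : ∀ σ κ, (Q σ κ).IsHermitian)

/-- The family in which the blocks OUTSIDE `S` have been replaced by the spectral projectors
selected by the patterns `E`, and the blocks in `S` are still the original `Q σ κ`. [folklore] -/
def mixFamily (S : Finset (Fin 2 × RectTorusSite k))
    (E : Fin 2 × RectTorusSite k → RectTorusSite M → Bool) :
    Fin 2 → RectTorusSite k → Matrix (RectTorusSite M) (RectTorusSite M) ℂ :=
  fun σ κ => if (σ, κ) ∈ S then Q σ κ else bernoulliProj (hQh σ κ) (E (σ, κ))

/-- With every block still original the mixture family is `Q`. [folklore] -/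
private theorem mixFamily_univ (E : Fin 2 × RectTorusSite k → RectTorusSite M → Bool) :
    mixFamily Q hQh Finset.univ E = Q := by
  funext σ κ
  simp [mixFamily]

omit [∀ i, NeZero (k i)] in
/-- With no block original every block is a spectral projector. [folklore] -/
private theorem mixFamily_empty (E : Fin 2 × RectTorusSite k → RectTorusSite M → Bool) (σ : Fin 2)
    (κ : RectTorusSite k) : mixFamily Q hQh ∅ E σ κ = bernoulliProj (hQh σ κ) (E (σ, κ)) := by
  simp [mixFamily]

omit [∀ i, NeZero (k i)] in
/-- Changing the pattern of block `b` does not change the blocks of the other spin. [folklore] -/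
private theorem mixFamily_update_of_ne (S : Finset (Fin 2 × RectTorusSite k))
    (E : Fin 2 × RectTorusSite k → RectTorusSite M → Bool) (b : Fin 2 × RectTorusSite k)
    (ε : RectTorusSite M → Bool) {τ : Fin 2} (hτ : τ ≠ b.1) :
    mixFamily Q hQh S (Function.update E b ε) τ = mixFamily Q hQh S E τ := by
  funext κ
  have hb : (τ, κ) ≠ b := fun h => hτ (by rw [← h])
  simp [mixFamily, Function.update_of_ne hb]

omit [∀ i, NeZero (k i)] in
/-- **One decomposition step**: releasing block `b ∉ S` writes the family as the product-Bernoulli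
average over the patterns of `b` of the families with `b` replaced by its spectral projectors.
[folklore] -/
private theorem mixFamily_insert (S : Finset (Fin 2 × RectTorusSite k)) {b : Fin 2 × RectTorusSite k}
    (hb : b ∉ S) (E : Fin 2 × RectTorusSite k → RectTorusSite M → Bool) :
    mixFamily Q hQh (insert b S) E = ∑ ε : RectTorusSite M → Bool,
      (bernoulliWeight (hQh b.1 b.2) ε : ℂ) • mixFamily Q hQh S (Function.update E b ε) := by
  funext σ κ
  rw [Finset.sum_apply, Finset.sum_apply]
  simp only [Pi.smul_apply]
  by_cases hσκ : (σ, κ) = b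
  · subst hσκ
    simp only [mixFamily, Finset.mem_insert_self, if_true, if_neg hb, Function.update_self]
    exact (sum_bernoulliWeight_smul_bernoulliProj (hQh σ κ)).symm
  · have hmem : ((σ, κ) ∈ insert b S) = ((σ, κ) ∈ S) := by
      rw [Finset.mem_insert, eq_iff_iff, or_iff_right hσκ]
    simp only [mixFamily, hmem, Function.update_of_ne hσκ]
    rw [← Finset.sum_smul,
      show ∑ ε : RectTorusSite M → Bool, (bernoulliWeight (hQh b.1 b.2) ε : ℂ) = 1 by
        exact_mod_cast sum_bernoulliWeight (hQh b.1 b.2), one_smul]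

end Mixture

/-! ### (M2) The Bloch bound for `0 ≤ Q ≤ 1` on the square lattice -/

section Thermodynamic

variable {L : ℕ} [NeZero L] {k M : Fin 2 → ℕ} [∀ i, NeZero (k i)] [∀ i, NeZero (M i)]

/-- Base case of the induction: every block a spectral projector. For a supporting line
`e(n̄) + s(x - n̄) ≤ e(x)` on `[0, 2)`:
`e(n̄) + s(N/L² - n̄) ≤ re blochEnergy / L² + 16|t|/L`, `N = Σ tr` (a natural number); the filled
member `N = 2L²` is the all-ones family with `re blochEnergy = U L²` against
`e(n̄) + s(2 - n̄) ≤ U`. [cite: BachLiebSolovej1994, eq. (2c.36)] -/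
theorem mixture_base (hkM : ∀ i, k i * M i = L) (hL : 3 ≤ L) (hM : ∀ i, 2 ≤ M i) (t : ℝ) {U : ℝ}
    (hU : 0 ≤ U) (Q : Fin 2 → RectTorusSite k → Matrix (RectTorusSite M) (RectTorusSite M) ℂ)
    (hQh : ∀ σ κ, (Q σ κ).IsHermitian) {nbar s : ℝ}
    (hs : ∀ x ∈ Set.Ico (0 : ℝ) 2, ThermodynamicLimit.energyDensity2D t U nbar + s * (x - nbar) ≤
      ThermodynamicLimit.energyDensity2D t U x)
    (E : Fin 2 × RectTorusSite k → RectTorusSite M → Bool) :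
    ThermodynamicLimit.energyDensity2D t U nbar +
        s * ((∑ σ, ∑ κ, (mixFamily Q hQh ∅ E σ κ).trace).re / (L : ℝ) ^ 2 - nbar) ≤
      (blochEnergy t U (mixFamily Q hQh ∅ E)).re / (L : ℝ) ^ 2 + 16 * |t| / L := by
  obtain ⟨X, hXdef⟩ : ∃ X, X = mixFamily Q hQh ∅ E := ⟨_, rfl⟩
  rw [← hXdef]
  have hX : ∀ σ κ, X σ κ = bernoulliProj (hQh σ κ) (E (σ, κ)) := by
    rw [hXdef]; exact mixFamily_empty Q hQh E
  have hL0 : (0 : ℝ) < L := by exact_mod_cast (show 0 < L by omega)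
  have hL2 : (0 : ℝ) < (L : ℝ) ^ 2 := by positivity
  have ht0 : 0 ≤ 16 * |t| / (L : ℝ) := by positivity
  -- the member's particle number
  obtain ⟨cnt, hcnt⟩ : ∃ cnt : Fin 2 × RectTorusSite k → ℕ,
      ∀ b, cnt b = (Finset.univ.filter fun i => E b i = true).card := ⟨_, fun b => rfl⟩
  obtain ⟨N, hNdef⟩ : ∃ N : ℕ, N = ∑ σ : Fin 2, ∑ κ : RectTorusSite k, cnt (σ, κ) := ⟨_, rfl⟩
  have htr : (∑ σ, ∑ κ, (X σ κ).trace) = (N : ℂ) := by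
    rw [hNdef]
    push_cast
    refine Finset.sum_congr rfl fun σ _ => Finset.sum_congr rfl fun κ _ => ?_
    rw [hX, trace_bernoulliProj, hcnt]
  have htrre : (∑ σ, ∑ κ, (X σ κ).trace).re / (L : ℝ) ^ 2 = (N : ℝ) / (L : ℝ) ^ 2 := by
    rw [htr, Complex.natCast_re]
  rw [htrre]
  have hcard : Fintype.card (RectTorusSite k) * Fintype.card (RectTorusSite M) = L * L := by
    rw [card_cells_mul_card_cell hkM, sq]
  by_cases hlt : N < 2 * (L * L)
  · -- a genuine particle-number sector: HF bound + tiling bound + supporting line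
    have h1 := hubbardTorus_groundEnergyAt_le_bloch hkM hL t U X
      (fun σ κ => by rw [hX]; exact isHermitian_bernoulliProj _ _)
      (fun σ κ => by rw [hX]; exact bernoulliProj_mul_self _ _) htr
    rw [groundEnergyAt_fermionTorusGraph_two] at h1
    have h2 := ThermodynamicLimit.energyDensity2D_le_of_lt t hU (show 1 ≤ L by omega) hlt
    have hNr : (N : ℝ) < 2 * (L : ℝ) ^ 2 := by
      have h' : ((N : ℕ) : ℝ) < ((2 * (L * L) : ℕ) : ℝ) := Nat.cast_lt.mpr hlt
      have h'' : ((2 * (L * L) : ℕ) : ℝ) = 2 * (L : ℝ) ^ 2 := by push_cast; ring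
      linarith
    have hx : (N : ℝ) / (L : ℝ) ^ 2 ∈ Set.Ico (0 : ℝ) 2 :=
      ⟨by positivity, by rw [div_lt_iff₀ hL2]; exact hNr⟩
    have h3 := hs _ hx
    have h4 := div_le_div_of_nonneg_right h1 hL2.le
    linarith
  · -- the filled member: every pattern is all-`true`, the family is all-ones
    have hle : ∀ b ∈ (Finset.univ : Finset (Fin 2 × RectTorusSite k)),
        cnt b ≤ Fintype.card (RectTorusSite M) := by
      intro b _
      rw [hcnt b]
      exact (Finset.card_filter_le _ _).trans (by rw [Finset.card_univ])
    have hsum_le : ∑ b, cnt b ≤ ∑ _b : Fin 2 × RectTorusSite k, Fintype.card (RectTorusSite M) :=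
      Finset.sum_le_sum hle
    have htot : ∑ _b : Fin 2 × RectTorusSite k, Fintype.card (RectTorusSite M) = 2 * (L * L) := by
      rw [Finset.sum_const, Finset.card_univ, Fintype.card_prod, Fintype.card_fin, smul_eq_mul,
        mul_assoc, hcard]
    have hNb : N = ∑ b, cnt b := by rw [hNdef, Fintype.sum_prod_type]
    have hNeq : ∑ b, cnt b = ∑ _b : Fin 2 × RectTorusSite k, Fintype.card (RectTorusSite M) := by
      apply le_antisymm hsum_le
      rw [htot]; rw [← hNb]; omega
    have hall : ∀ b, cnt b = Fintype.card (RectTorusSite M) :=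
      fun b => (Finset.sum_eq_sum_iff_of_le hle).mp hNeq b (Finset.mem_univ b)
    have hE : ∀ b, E b = fun _ => true := by
      intro b
      have hb := hall b
      rw [hcnt b, Finset.card_eq_iff_eq_univ, Finset.eq_univ_iff_forall] at hb
      funext i
      simpa using hb i
    have hX1 : X = fun _ _ => (1 : Matrix (RectTorusSite M) (RectTorusSite M) ℂ) := by
      funext σ κ
      rw [hX, hE, bernoulliProj_const_true]
    have hN2 : (N : ℝ) = 2 * (L : ℝ) ^ 2 := by
      rw [hNb, hNeq, htot]
      push_cast
      ring
    rw [hX1, blochEnergy_one hkM hM, hN2]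
    have h5 := ThermodynamicLimit.supporting_line_at_two_le t hU hs
    have h6 : ((U : ℂ) * ((L ^ 2 : ℕ) : ℂ)).re / (L : ℝ) ^ 2 = U := by
      have : ((U : ℂ) * ((L ^ 2 : ℕ) : ℂ)).re = U * (L : ℝ) ^ 2 := by
        rw [← Complex.ofReal_natCast, ← Complex.ofReal_mul, Complex.ofReal_re]
        push_cast
        ring
      rw [this, mul_div_assoc, div_self hL2.ne', mul_one]
    rw [h6, show 2 * (L : ℝ) ^ 2 / (L : ℝ) ^ 2 = 2 by field_simp]
    linarith

/-- **Bloch-state upper bound for non-idempotent blocks (Lieb's variational principle, collinear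
Hubbard case).** `d = 2`, `U ≥ 0`, `L ≥ 3`, a rectangular magnetic cell with sides `M i ≥ 2`,
`k i · M i = L`, blocks `0 ≤ Q σ κ ≤ 1` (Loewner order) with mean filling
`n̄ = re Σ_{σ,κ} tr Q σ κ / L² ∈ (0, 2)`:

  `e(t, U; n̄) ≤ re blochEnergy t U Q / L² + 16|t|/L`.

Proof: release the blocks one at a time (`mixFamily_insert`: the released block is the
product-Bernoulli average of its spectral projectors, `blochEnergy` is affine along such one-spin
mixtures and so is the total trace), down to families of projectors (`mixture_base`: the
Hartree–Fock bound `hubbardTorus_groundEnergyAt_le_bloch`, the tiling bound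
`energyDensity2D_le_of_lt`, and a supporting line of the convex `e` at `n̄` absorb the members'
integer fillings). This is BLS94 (2c.36) `E^Q ≤ E^{HF}(γ)` for `0 ≤ γ ≤ 1` in the spin-diagonal
(no exchange between ↑ and ↓) Hubbard setting, where the product decomposition is elementary.
[cite: BachLiebSolovej1994, eq. (2c.36)] -/
theorem energyDensity2D_le_bloch_of_posSemidef (hkM : ∀ i, k i * M i = L) (hL : 3 ≤ L)
    (hM : ∀ i, 2 ≤ M i) (t : ℝ) {U : ℝ} (hU : 0 ≤ U)
    (Q : Fin 2 → RectTorusSite k → Matrix (RectTorusSite M) (RectTorusSite M) ℂ)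
    (hQ0 : ∀ σ κ, (Q σ κ).PosSemidef) (hQ1 : ∀ σ κ, (1 - Q σ κ).PosSemidef)
    (hn0 : 0 < (∑ σ, ∑ κ, (Q σ κ).trace).re / (L : ℝ) ^ 2)
    (hn2 : (∑ σ, ∑ κ, (Q σ κ).trace).re / (L : ℝ) ^ 2 < 2) :
    ThermodynamicLimit.energyDensity2D t U ((∑ σ, ∑ κ, (Q σ κ).trace).re / (L : ℝ) ^ 2) ≤
      (blochEnergy t U Q).re / (L : ℝ) ^ 2 + 16 * |t| / L := by
  set nbar := (∑ σ, ∑ κ, (Q σ κ).trace).re / (L : ℝ) ^ 2 with hnbar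
  have hQh : ∀ σ κ, (Q σ κ).IsHermitian := fun σ κ => (hQ0 σ κ).isHermitian
  obtain ⟨s, hs⟩ := ThermodynamicLimit.exists_supporting_line_energyDensity2D t hU hn0 hn2
  suffices key : ∀ S : Finset (Fin 2 × RectTorusSite k),
      ∀ E : Fin 2 × RectTorusSite k → RectTorusSite M → Bool,
        ThermodynamicLimit.energyDensity2D t U nbar +
            s * ((∑ σ, ∑ κ, (mixFamily Q hQh S E σ κ).trace).re / (L : ℝ) ^ 2 - nbar) ≤
          (blochEnergy t U (mixFamily Q hQh S E)).re / (L : ℝ) ^ 2 + 16 * |t| / L by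
    have h := key Finset.univ (fun _ _ => true)
    rw [mixFamily_univ] at h
    have h0 : (∑ σ, ∑ κ, (Q σ κ).trace).re / (L : ℝ) ^ 2 - nbar = 0 := by rw [hnbar, sub_self]
    rw [h0, mul_zero, add_zero] at h
    exact h
  intro S
  induction S using Finset.induction_on with
  | empty => exact fun E => mixture_base hkM hL hM t hU Q hQh hs E
  | @insert b S' hb ih =>
    intro E
    rw [mixFamily_insert Q hQh S' hb E]
    set w : (RectTorusSite M → Bool) → ℝ := fun ε => bernoulliWeight (hQh b.1 b.2) ε with hw
    set Y : (RectTorusSite M → Bool) → Fin 2 → RectTorusSite k →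
        Matrix (RectTorusSite M) (RectTorusSite M) ℂ := fun ε => mixFamily Q hQh S' (Function.update E b ε)
      with hY
    have hw0 : ∀ ε, 0 ≤ w ε := fun ε =>
      bernoulliWeight_nonneg_of_posSemidef _ (hQ0 b.1 b.2) (hQ1 b.1 b.2) ε
    have hw1 : ∑ ε, w ε = 1 := sum_bernoulliWeight _
    have hw1c : ∑ ε, (w ε : ℂ) = 1 := by exact_mod_cast hw1
    have hτ : b.1 + 1 ≠ b.1 := by
      have h2 : ∀ x : Fin 2, x + 1 ≠ x := by decide
      exact h2 b.1
    have hG : ∀ ε ∈ (Finset.univ : Finset (RectTorusSite M → Bool)),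
        Y ε (b.1 + 1) = mixFamily Q hQh S' E (b.1 + 1) :=
      fun ε _ => mixFamily_update_of_ne Q hQh S' E b ε hτ
    have hE : blochEnergy t U (∑ ε, (w ε : ℂ) • Y ε) = ∑ ε, (w ε : ℂ) * blochEnergy t U (Y ε) :=
      blochEnergy_sum_smul_of_spin_eq t U Finset.univ (fun ε => (w ε : ℂ)) hw1c Y (b.1 + 1)
        (mixFamily Q hQh S' E (b.1 + 1)) hG
    have hEre : (blochEnergy t U (∑ ε, (w ε : ℂ) • Y ε)).re =
        ∑ ε, w ε * (blochEnergy t U (Y ε)).re := by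
      rw [hE, Complex.re_sum]
      refine Finset.sum_congr rfl fun ε _ => ?_
      rw [Complex.re_ofReal_mul]
    have hN : (∑ σ, ∑ κ, ((∑ ε, (w ε : ℂ) • Y ε) σ κ).trace).re =
        ∑ ε, w ε * (∑ σ, ∑ κ, (Y ε σ κ).trace).re := by
      rw [totalTrace_sum_smul, Complex.re_sum]
      refine Finset.sum_congr rfl fun ε _ => ?_
      rw [Complex.re_ofReal_mul]
    change ThermodynamicLimit.energyDensity2D t U nbar +
        s * ((∑ σ, ∑ κ, ((∑ ε, (w ε : ℂ) • Y ε) σ κ).trace).re / (L : ℝ) ^ 2 - nbar) ≤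
      (blochEnergy t U (∑ ε, (w ε : ℂ) • Y ε)).re / (L : ℝ) ^ 2 + 16 * |t| / L
    rw [hEre, hN]
    -- both sides are the `w`-averages of the members' sides
    have key : ∑ ε, w ε * (ThermodynamicLimit.energyDensity2D t U nbar +
        s * ((∑ σ, ∑ κ, (Y ε σ κ).trace).re / (L : ℝ) ^ 2 - nbar)) ≤
        ∑ ε, w ε * ((blochEnergy t U (Y ε)).re / (L : ℝ) ^ 2 + 16 * |t| / L) :=
      Finset.sum_le_sum fun ε _ => mul_le_mul_of_nonneg_left (ih (Function.update E b ε)) (hw0 ε)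
    have hA : ∑ ε, w ε * ThermodynamicLimit.energyDensity2D t U nbar =
        ThermodynamicLimit.energyDensity2D t U nbar := by rw [← Finset.sum_mul, hw1, one_mul]
    have hB : ∑ ε, w ε * (s * nbar) = s * nbar := by rw [← Finset.sum_mul, hw1, one_mul]
    have hC : ∑ ε, w ε * (16 * |t| / (L : ℝ)) = 16 * |t| / L := by rw [← Finset.sum_mul, hw1, one_mul]
    have hD : ∑ ε, w ε * (s * ((∑ σ, ∑ κ, (Y ε σ κ).trace).re / (L : ℝ) ^ 2)) =
        s * (∑ ε, w ε * (∑ σ, ∑ κ, (Y ε σ κ).trace).re) / (L : ℝ) ^ 2 := by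
      rw [Finset.mul_sum, Finset.sum_div]
      exact Finset.sum_congr rfl fun ε _ => by ring
    have hF : ∑ ε, w ε * ((blochEnergy t U (Y ε)).re / (L : ℝ) ^ 2) =
        (∑ ε, w ε * (blochEnergy t U (Y ε)).re) / (L : ℝ) ^ 2 := by
      rw [Finset.sum_div]
      exact Finset.sum_congr rfl fun ε _ => by ring
    have hsplitL : ∀ ε, w ε * (ThermodynamicLimit.energyDensity2D t U nbar +
        s * ((∑ σ, ∑ κ, (Y ε σ κ).trace).re / (L : ℝ) ^ 2 - nbar)) =
        w ε * ThermodynamicLimit.energyDensity2D t U nbar +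
          (w ε * (s * ((∑ σ, ∑ κ, (Y ε σ κ).trace).re / (L : ℝ) ^ 2)) - w ε * (s * nbar)) :=
      fun ε => by ring
    have hsplitR : ∀ ε, w ε * ((blochEnergy t U (Y ε)).re / (L : ℝ) ^ 2 + 16 * |t| / L) =
        w ε * ((blochEnergy t U (Y ε)).re / (L : ℝ) ^ 2) + w ε * (16 * |t| / (L : ℝ)) :=
      fun ε => by ring
    have eqL : ∑ ε, w ε * (ThermodynamicLimit.energyDensity2D t U nbar +
        s * ((∑ σ, ∑ κ, (Y ε σ κ).trace).re / (L : ℝ) ^ 2 - nbar)) =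
        ThermodynamicLimit.energyDensity2D t U nbar +
          s * ((∑ ε, w ε * (∑ σ, ∑ κ, (Y ε σ κ).trace).re) / (L : ℝ) ^ 2 - nbar) := by
      rw [Finset.sum_congr rfl fun ε _ => hsplitL ε, Finset.sum_add_distrib, Finset.sum_sub_distrib,
        hA, hB, hD]
      ring
    have eqR : ∑ ε, w ε * ((blochEnergy t U (Y ε)).re / (L : ℝ) ^ 2 + 16 * |t| / L) =
        (∑ ε, w ε * (blochEnergy t U (Y ε)).re) / (L : ℝ) ^ 2 + 16 * |t| / L := by
      rw [Finset.sum_congr rfl fun ε _ => hsplitR ε, Finset.sum_add_distrib, hC, hF]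
    linarith [key, eqL, eqR]

end Thermodynamic

end HartreeFock

end Literature.MathematicalPhysics.QuantumLattice
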